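/-
Copyright: the b2b-balaban cell (near-miss cell 7), T⁴-continuum fan-out; row NE7b ROUND-2 swarm, seat
t4-ne7b-formalise-leaf-02 (gen 6) — supplier piece for the S6g′ INSTANCE's T3b «injection» (owner's rulings
R-OWNER-22-23∕-24, holder leaf-05 g3): the inverse of `cfg` and the top-join rearrangement (journal OFFER l.12803).
A supplier module consumed BY NAME; not a claim of T3b.  Released under the licence of the surrounding project.
-/
import Summits.QuantumFields.BalabanUV.T4Continuum.Support.HistorySiblingCanonExist
import Summits.QuantumFields.BalabanUV.T4Continuum.Support.HistoryJoinsTag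

/-!
# History joins, part 2′: GLUING the parts' placements and the top-join REARRANGEMENT (the inverse of `cfg`)

Summits-side support leaf of the T⁴-continuum cell (rung (B)+1 on a FINITE torus only; NOT infinite volume, NOT the
mass gap, NOT the Clay statement; NOT a proof of the spine estimate NE7b).  Row NE7b, route «COUNT», row S6g′
INSTANCE, piece T3b (R-OWNER-22-23): under wiring (α′) (R-OWNER-22-22 (3)) a history read into a slot is sent to
«its ρ-TIE-BROKEN sorted PLACED tree», a member of the counted set `HistoryJoinsAdm.S zone ρ c₀ st G z`.  Leaf-05
g2's `HistoryJoinsCount.card_S_merge_le` has the INJECTION direction only (`S (merge X Y e) z ↪` the sorted forests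
over the host's placements, by `cfg` and `eq_of_rel_eq`); the CONSTRUCTION of a member of `S` from placed parts goes
the other way, and this file supplies it.  [folklore] finite tree surgery over the lineage's own carriers (`Gen ε`,
`Addr D`, `evalA`, `rel`, `Junk`, `cfg`, `S`, `CAdm`, `keyPerms`); nothing is quoted from print, nothing printed is
asserted, no `[cite:]` tag, no `Prop`-valued fact minted; the two definitions are plain functions (`glue`,
`permTop`).  Imports gen 5's `HistorySiblingCanonExist` (→ `HistoryJoinsCount` → `HistoryJoinsAdm`) and leaf-05 g2's
`HistoryJoinsTag` (for `part_injective`: the top join's parts are indexed injectively).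

WHAT (`G := Gen.merge X Y e`, host `h := hostIdx st X Y e`; the DEPTH side condition
`hD : ∀ a ∈ baddr G, a.length ≤ D` — every birth address is an address of the space `Addr D` — where marked).
* §1 GLUE: `exists_part_decomp` ∕ `append_mem_baddr` ∕ `part_decomp_unique` (a birth address of `G` is UNIQUELY
  `(part i).1 ++ r` with `r ∈ baddr (part i).2`), **`glue c₀ st X Y e c`** (the placement of `G` reading
  `evalA c₀ (c i) r` at `(part i).1 ++ r`, junk `c₀` elsewhere), `junk_glue`, `glue_apply_append`,
  `evalA_glue_append` (hD), **`cfg_glue`** (hD; `cfg ∘ glue = id` on junk configurations), `junk_cfg`,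
  **`glue_cfg`** (hD; `glue ∘ cfg = id` on junk placements), `evalA_glue_rootAddr` (hD; the root value is the
  host's), **`glue_mem_S`** (hD; canonically admissibly placed parts + a `touch0`-forest around the host + `Sorted` ⇒
  `glue c ∈ S … G (root value)`), `cfg_host_mem_S`, **`mem_S_merge_iff`** (hD; the image of `card_S_merge_le`'s
  injection is EXACTLY the set of sorted `okJ`-forests over `S (host) z`).
* §2 REARRANGEMENT by a class-preserving relabelling `σ : keyPerms (key st X Y e)` of the top join's parts:
  `junk_smul`, `mem_Sany_smul`, **`permTop c₀ st X Y e σ P := glue … (σ • cfg … P)`**, `junk_permTop`,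
  `cfg_permTop` (hD), `evalA_permTop_rootAddr` (hD; root value kept — the host is alone in its class), and WITH GEN
  5's ρ-tie-break `exists_localTop_smul_of_connected`: **`exists_glue_smul_mem_S`** ∕ **`exists_permTop_mem_S`** —
  canonically admissibly placed parts whose `touch0` graph is connected from the host, with root read-outs distinct
  within classes, admit a top rearrangement IN `S … G (root value)`: the inductive step of T3b (i).  §3 sanity.

HONEST SCOPE.  One join.  The births' reading and the recursion over all joins are part 2″ (`HistoryJoinsRearrange`).
The binding to realised members (`zone`, `ρ`, the placement value `γ′ = cell × template` of F-leaf05g3-2, realised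
contact ⇒ `touch0`-connectedness, disjoint regions ⇒ distinct read-outs, the template factor, injectivity on the
slot's occupants) is T3b proper (its holder's), NOT here.  Nothing of H3∕(B)∕BetaPertH touched;
`BirthShapeNodup`∕`resum` NOT retired by this file; NE7b NOT proved; spine 0∕9.  HONEST DEPENDENCY (cell):
continuum YM on T⁴ ⇐ BetaPertH ∧ nine spine estimates (0/9 proved); BetaPertH ⇐ (D1) ∧ (D4) ∧ CAP+tail; G-an2-4
gates asym, D1 and NE2/3/4.  This file changes none of it.
-/

open Finset
open Literature.MathematicalPhysics.QuantumFieldTheory.Balaban1983to89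
open T4PersistenceDictionary T4PartnerMultiplicity T4BranchingRecordsGas
open Summit.QuantumFields.BalabanUV.T4Continuum.HistorySiblingSymmetry
open Summit.QuantumFields.BalabanUV.T4Continuum.HistorySiblingOrbits
open Summit.QuantumFields.BalabanUV.T4Continuum.HistorySiblingCanon
open Summit.QuantumFields.BalabanUV.T4Continuum.HistorySiblingCanonExist
open Summit.QuantumFields.BalabanUV.T4Continuum.HistoryJoins
open Summit.QuantumFields.BalabanUV.T4Continuum.HistoryJoinsAdm
open Summit.QuantumFields.BalabanUV.T4Continuum.HistoryJoinsCount
open Summit.QuantumFields.BalabanUV.T4Continuum.HistoryJoinsTag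

namespace Summit.QuantumFields.BalabanUV.T4Continuum.HistoryJoinsGlue

noncomputable section

open scoped Classical

/-! ## §1 Gluing the parts' placements: the inverse of `cfg` -/

section Glue

variable {ε γ : Type*} {D : ℕ} (c₀ : γ) (st : ε → ℕ) (X Y : Gen ε) (e : ε)

/-- a birth address of the merger is a part's path followed by a birth address of that part [folklore] -/
theorem exists_part_decomp {a : List Bool} (ha : a ∈ baddr (Gen.merge X Y e)) :
    ∃ i : Fin (npart st (Gen.merge X Y e)), ∃ r ∈ baddr (part st _ i).2, a = (part st _ i).1 ++ r := by
  obtain ⟨q, hq, r, hr, rfl⟩ := (mem_baddr_iff_clusterParts st (st e) (Gen.merge X Y e) a).1 ha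
  obtain ⟨i, hi⟩ := exists_part_eq st (G := Gen.merge X Y e) (by simpa [jparts] using hq)
  exact ⟨i, r, by rw [hi]; exact hr, by rw [hi]⟩

/-- conversely such a concatenation is a birth address of the merger [folklore] -/
theorem append_mem_baddr (i : Fin (npart st (Gen.merge X Y e))) {r : List Bool} (hr : r ∈ baddr (part st _ i).2) :
    (part st _ i).1 ++ r ∈ baddr (Gen.merge X Y e) :=
  (mem_baddr_iff_clusterParts st (st e) _ _).2 ⟨part st _ i, by simpa [jparts] using part_mem st _ i, r, hr, rfl⟩

/-- … and the decomposition is unique [folklore] -/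
theorem part_decomp_unique {i j : Fin (npart st (Gen.merge X Y e))} {r s : List Bool}
    (h : (part st _ i).1 ++ r = (part st _ j).1 ++ s) : i = j ∧ r = s := by
  obtain ⟨h1, h2⟩ := eq_of_append_eq st (st e) (Gen.merge X Y e) (part st _ i)
    (by simpa [jparts] using part_mem st _ i) (part st _ j) (by simpa [jparts] using part_mem st _ j) r s h
  exact ⟨part_injective st _ h1, h2⟩

/-- **GLUE**: the placement of the merger that reads `evalA c₀ (c i) r` at the address `(part i).1 ++ r` of each birth of
each part, and the junk value `c₀` off the birth addresses. [folklore] -/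
def glue (c : Fin (npart st (Gen.merge X Y e)) → (Addr D → γ)) : Addr D → γ := fun a =>
  if ha : a.1 ∈ baddr (Gen.merge X Y e) then
    evalA c₀ (c (Classical.choose (exists_part_decomp st X Y e ha)))
      (Classical.choose (Classical.choose_spec (exists_part_decomp st X Y e ha)))
  else c₀

variable {c₀ st X Y e}

/-- off the birth addresses the glued placement is junk [folklore] -/
theorem glue_apply_of_not_mem (c : Fin (npart st (Gen.merge X Y e)) → (Addr D → γ)) {a : Addr D}
    (ha : a.1 ∉ baddr (Gen.merge X Y e)) : glue c₀ st X Y e c a = c₀ := by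
  simp [glue, ha]

/-- **THE GLUED PLACEMENT IS JUNK OFF THE BIRTHS.** [folklore] -/
theorem junk_glue (c : Fin (npart st (Gen.merge X Y e)) → (Addr D → γ)) :
    Junk (Gen.merge X Y e) c₀ (glue c₀ st X Y e c) :=
  fun _ ha => glue_apply_of_not_mem c ha

/-- the glued placement at a birth address of part `i` [folklore] -/
theorem glue_apply_append (c : Fin (npart st (Gen.merge X Y e)) → (Addr D → γ)) (i : Fin (npart st (Gen.merge X Y e)))
    {r : List Bool} (hr : r ∈ baddr (part st _ i).2) (hlen : ((part st _ i).1 ++ r).length ≤ D) :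
    glue c₀ st X Y e c ⟨(part st _ i).1 ++ r, hlen⟩ = evalA c₀ (c i) r := by
  have ha : (part st _ i).1 ++ r ∈ baddr (Gen.merge X Y e) := append_mem_baddr st X Y e i hr
  unfold glue
  rw [dif_pos ha]
  set j := Classical.choose (exists_part_decomp st X Y e ha) with hj
  set s := Classical.choose (Classical.choose_spec (exists_part_decomp st X Y e ha)) with hs
  have hspec : s ∈ baddr (part st _ j).2 ∧ (part st _ i).1 ++ r = (part st _ j).1 ++ s :=
    Classical.choose_spec (Classical.choose_spec (exists_part_decomp st X Y e ha))
  obtain ⟨hij, hrs⟩ := part_decomp_unique st X Y e hspec.2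
  have hc : c j = c i := by rw [hij]
  rw [hc, ← hrs]

/-- **EVALUATION OF THE GLUED PLACEMENT ALONG A PART** (depth side condition). [folklore] -/
theorem evalA_glue_append (hD : ∀ a ∈ baddr (Gen.merge X Y e), a.length ≤ D)
    (c : Fin (npart st (Gen.merge X Y e)) → (Addr D → γ)) (i : Fin (npart st (Gen.merge X Y e))) {r : List Bool}
    (hr : r ∈ baddr (part st _ i).2) :
    evalA c₀ (glue c₀ st X Y e c) ((part st _ i).1 ++ r) = evalA c₀ (c i) r := by
  rw [evalA_of_le c₀ _ (hD _ (append_mem_baddr st X Y e i hr)), glue_apply_append c i hr]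

/-- **`cfg ∘ glue = id` ON JUNK CONFIGURATIONS**: the relative placements of the glued placement are the given ones.
[folklore] -/
theorem cfg_glue (hD : ∀ a ∈ baddr (Gen.merge X Y e), a.length ≤ D)
    (c : Fin (npart st (Gen.merge X Y e)) → (Addr D → γ)) (hc : ∀ i, Junk (part st _ i).2 c₀ (c i)) :
    cfg c₀ st X Y e (glue c₀ st X Y e c) = c := by
  funext i r
  show evalA c₀ (glue c₀ st X Y e c) ((part st _ i).1 ++ r.1) = c i r
  by_cases hr : r.1 ∈ baddr (part st _ i).2
  · rw [evalA_glue_append hD c i hr, evalA_coe]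
  · rw [hc i r hr]
    by_cases hlen : ((part st _ i).1 ++ r.1).length ≤ D
    · rw [evalA_of_le c₀ _ hlen]
      apply glue_apply_of_not_mem
      intro hmem
      obtain ⟨j, s, hs, heq⟩ := exists_part_decomp st X Y e hmem
      obtain ⟨hij, hrs⟩ := part_decomp_unique st X Y e heq
      subst hij
      rw [hrs] at hr
      exact hr hs
    · rw [evalA, dif_neg hlen]

/-- the relative placements of a junk placement are junk [folklore] -/
theorem junk_cfg {P : Addr D → γ} (hJ : Junk (Gen.merge X Y e) c₀ P) (i : Fin (npart st (Gen.merge X Y e))) :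
    Junk (part st _ i).2 c₀ (cfg c₀ st X Y e P i) :=
  junk_rel st hJ (t := st e) (by simpa [jparts] using part_mem st (Gen.merge X Y e) i)

/-- **`glue ∘ cfg = id` ON JUNK PLACEMENTS.** [folklore] -/
theorem glue_cfg (hD : ∀ a ∈ baddr (Gen.merge X Y e), a.length ≤ D) {P : Addr D → γ}
    (hJ : Junk (Gen.merge X Y e) c₀ P) : glue c₀ st X Y e (cfg c₀ st X Y e P) = P := by
  refine eq_of_rel_eq st (junk_glue _) hJ (st e) fun q hq => ?_
  obtain ⟨i, hi⟩ := exists_part_eq st (G := Gen.merge X Y e) (by simpa [jparts] using hq)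
  rw [← hi]
  exact congrFun (cfg_glue hD _ (junk_cfg hJ)) i

/-- **THE ROOT VALUE OF THE GLUED PLACEMENT IS THE HOST'S.** [folklore] -/
theorem evalA_glue_rootAddr (hD : ∀ a ∈ baddr (Gen.merge X Y e), a.length ≤ D)
    (c : Fin (npart st (Gen.merge X Y e)) → (Addr D → γ)) :
    evalA c₀ (glue c₀ st X Y e c) (rootAddr (Gen.merge X Y e)) =
      evalA c₀ (c (hostIdx st X Y e)) (rootAddr (part st _ (hostIdx st X Y e)).2) := by
  rw [rootAddr_eq_host st X Y e, evalA_glue_append hD c _ (rootAddr_mem_baddr _)]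

variable {β R : Type*} [DecidableEq β] [LinearOrder R] [Fintype γ]
  {zone : ℕ → Gen ε → (Addr D → γ) → Finset β} {ρ : (Addr D → γ) → R}

/-- **GLUED MEMBERS OF `S`**: if every part is placed by a canonically admissible junk placement, the parts' zones at
the join step form a `touch0`-forest around the host, and the configuration is sorted within classes, then the glued
placement is counted — `glue c ∈ S zone ρ c₀ st (merge X Y e) (root value of the host)`. [folklore] -/
theorem glue_mem_S (hD : ∀ a ∈ baddr (Gen.merge X Y e), a.length ≤ D)
    {c : Fin (npart st (Gen.merge X Y e)) → (Addr D → γ)} (hc : ∀ i, c i ∈ Sany zone ρ c₀ st (part st _ i).2)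
    (hF : ForestAdm (fun _ _ => True) (touch0 zone st X Y e) (hostIdx st X Y e) c)
    (hS : Sorted (key st X Y e) ρ c) :
    glue c₀ st X Y e c ∈
      S zone ρ c₀ st (Gen.merge X Y e)
        (evalA c₀ (c (hostIdx st X Y e)) (rootAddr (part st _ (hostIdx st X Y e)).2)) := by
  have hcj : ∀ i, Junk (part st _ i).2 c₀ (c i) := fun i => (mem_Sany.1 (hc i)).1
  have hcfg := cfg_glue hD c hcj
  have hLT : LocalTop zone ρ c₀ st (Gen.merge X Y e) (glue c₀ st X Y e c) := by
    show ForestAdm _ _ _ (cfg c₀ st X Y e (glue c₀ st X Y e c)) ∧ Sorted _ _ (cfg c₀ st X Y e (glue c₀ st X Y e c))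
    rw [hcfg]
    exact ⟨hF, hS⟩
  rw [mem_S]
  refine ⟨junk_glue _, (cadm_merge_iff zone ρ c₀ st X Y e _).2 ⟨hLT, fun i => ?_⟩, evalA_glue_rootAddr hD c⟩
  rw [hcfg]
  exact (mem_Sany.1 (hc i)).2

/-- the host's relative placement of a member of `S (merge X Y e) z` is a member of `S (host) z` [folklore] -/
theorem cfg_host_mem_S {P : Addr D → γ} {z : γ} (hP : P ∈ S zone ρ c₀ st (Gen.merge X Y e) z) :
    cfg c₀ st X Y e P (hostIdx st X Y e) ∈ S zone ρ c₀ st (part st _ (hostIdx st X Y e)).2 z := by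
  have h1 := cfg_mem_Sany (mem_Sany_of_mem_S hP) (hostIdx st X Y e)
  rw [mem_Sany] at h1
  rw [mem_S] at hP ⊢
  exact ⟨h1.1, h1.2, by rw [evalA_cfg_host, hP.2.2]⟩

/-- **THE COUNTED SET OF A MERGER, CHARACTERISED THROUGH `cfg`**: a placement is in `S (merge X Y e) z` iff it is junk,
its host's relative placement is in `S (host) z`, every part's relative placement is canonically admissible, and the
configuration of relative placements is a `touch0`-forest around the host and sorted within classes — the image of
`HistoryJoinsCount.card_S_merge_le`'s injection is exactly this set. [folklore] -/
theorem mem_S_merge_iff (hD : ∀ a ∈ baddr (Gen.merge X Y e), a.length ≤ D) {P : Addr D → γ} {z : γ} :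
    P ∈ S zone ρ c₀ st (Gen.merge X Y e) z ↔
      Junk (Gen.merge X Y e) c₀ P ∧
        cfg c₀ st X Y e P (hostIdx st X Y e) ∈ S zone ρ c₀ st (part st _ (hostIdx st X Y e)).2 z ∧
          (∀ i, cfg c₀ st X Y e P i ∈ Sany zone ρ c₀ st (part st _ i).2) ∧
            ForestAdm (fun _ _ => True) (touch0 zone st X Y e) (hostIdx st X Y e) (cfg c₀ st X Y e P) ∧
              Sorted (key st X Y e) ρ (cfg c₀ st X Y e P) := by
  constructor
  · intro hP
    have hany := mem_Sany_of_mem_S hP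
    have hhost := cfg_host_mem_S hP
    rw [mem_S] at hP
    obtain ⟨hJ, hC, -⟩ := hP
    obtain ⟨hF, hS⟩ : LocalTop zone ρ c₀ st (Gen.merge X Y e) P := ((cadm_merge_iff zone ρ c₀ st X Y e P).1 hC).1
    exact ⟨hJ, hhost, cfg_mem_Sany hany, hF, hS⟩
  · rintro ⟨hJ, hhost, hc, hF, hS⟩
    have hmem := glue_mem_S hD hc hF hS
    rw [glue_cfg hD hJ, (mem_S.1 hhost).2.2] at hmem
    exact hmem

end Glue

/-! ## §2 The top-join rearrangement by a class-preserving relabelling -/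

section Rearrange

variable {ε γ : Type*} {D : ℕ} (c₀ : γ) (st : ε → ℕ) (X Y : Gen ε) (e : ε)

/-- relabelled junk configurations are junk (equal keys = equal parts) [folklore] -/
theorem junk_smul {c : Fin (npart st (Gen.merge X Y e)) → (Addr D → γ)} (hc : ∀ i, Junk (part st _ i).2 c₀ (c i))
    (σ : keyPerms (key st X Y e)) (i : Fin (npart st (Gen.merge X Y e))) : Junk (part st _ i).2 c₀ ((σ • c) i) := by
  rw [smul_apply, ← part_eq_of_key_eq st X Y e (key_symm_apply σ i)]
  exact hc _

/-- **THE TOP-JOIN REARRANGEMENT**: permute the parts' relative placements along `σ` and glue. [folklore] -/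
def permTop (σ : keyPerms (key st X Y e)) (P : Addr D → γ) : Addr D → γ :=
  glue c₀ st X Y e (σ • cfg c₀ st X Y e P)

variable {c₀ st X Y e}

/-- the rearranged placement is junk off the births [folklore] -/
theorem junk_permTop (σ : keyPerms (key st X Y e)) (P : Addr D → γ) :
    Junk (Gen.merge X Y e) c₀ (permTop c₀ st X Y e σ P) :=
  junk_glue _

/-- **THE RELATIVE PLACEMENTS OF THE REARRANGED PLACEMENT ARE THE PERMUTED ONES.** [folklore] -/
theorem cfg_permTop (hD : ∀ a ∈ baddr (Gen.merge X Y e), a.length ≤ D) {P : Addr D → γ}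
    (hJ : Junk (Gen.merge X Y e) c₀ P) (σ : keyPerms (key st X Y e)) :
    cfg c₀ st X Y e (permTop c₀ st X Y e σ P) = σ • cfg c₀ st X Y e P :=
  cfg_glue hD _ (junk_smul c₀ st X Y e (junk_cfg hJ) σ)

/-- **THE ROOT VALUE IS KEPT** (the host is alone in its class, so `σ` fixes it). [folklore] -/
theorem evalA_permTop_rootAddr (hD : ∀ a ∈ baddr (Gen.merge X Y e), a.length ≤ D) (σ : keyPerms (key st X Y e))
    (P : Addr D → γ) :
    evalA c₀ (permTop c₀ st X Y e σ P) (rootAddr (Gen.merge X Y e)) = evalA c₀ P (rootAddr (Gen.merge X Y e)) := by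
  rw [permTop, evalA_glue_rootAddr hD, smul_apply_host (eq_host_of_key_eq st X Y e) σ, evalA_cfg_host]

variable {β R : Type*} [DecidableEq β] [LinearOrder R] [Fintype γ]
  {zone : ℕ → Gen ε → (Addr D → γ) → Finset β} {ρ : (Addr D → γ) → R}

/-- relabelled canonically admissible configurations are canonically admissible (leaf-05 g2's `okJ_iff_of_key_eq`)
[folklore] -/
theorem mem_Sany_smul {c : Fin (npart st (Gen.merge X Y e)) → (Addr D → γ)}
    (hc : ∀ i, c i ∈ Sany zone ρ c₀ st (part st _ i).2) (σ : keyPerms (key st X Y e))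
    (i : Fin (npart st (Gen.merge X Y e))) : (σ • c) i ∈ Sany zone ρ c₀ st (part st _ i).2 := by
  rw [smul_apply, ← part_eq_of_key_eq st X Y e (key_symm_apply σ i)]
  exact hc _

/-- **THE INDUCTIVE STEP OF T3b (i), CONFIGURATION FORM.**  If every part of the top join is placed by a canonically
admissible junk placement, the `touch0` graph of the placed parts («zones at the join step share a block») reaches
every part from the host, and the root read-outs `ρ` are distinct within classes, then SOME class-preserving
relabelling `σ` (gen 5's ρ-tie-break `exists_localTop_smul_of_connected`) fixes the host's placement, sorts the
configuration, and glues to a member of `S zone ρ c₀ st (merge X Y e) (root value of the host)`. [folklore] -/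
theorem exists_glue_smul_mem_S (hD : ∀ a ∈ baddr (Gen.merge X Y e), a.length ≤ D)
    {c : Fin (npart st (Gen.merge X Y e)) → (Addr D → γ)} (hc : ∀ i, c i ∈ Sany zone ρ c₀ st (part st _ i).2)
    (hconn : ∀ i, (SimpleGraph.fromRel fun i j => touch0 zone st X Y e i (c i) j (c j)).Reachable (hostIdx st X Y e) i)
    (hρ : RootInj (key st X Y e) ρ c) :
    ∃ σ : keyPerms (key st X Y e), (σ • c) (hostIdx st X Y e) = c (hostIdx st X Y e) ∧
      Sorted (key st X Y e) ρ (σ • c) ∧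
        glue c₀ st X Y e (σ • c) ∈
          S zone ρ c₀ st (Gen.merge X Y e)
        (evalA c₀ (c (hostIdx st X Y e)) (rootAddr (part st _ (hostIdx st X Y e)).2)) := by
  obtain ⟨σ, hh, hF, hS⟩ := exists_localTop_smul_of_connected zone ρ st X Y e hconn hρ
  refine ⟨σ, hh, hS, ?_⟩
  have hmem := glue_mem_S hD (mem_Sany_smul hc σ) hF hS
  rwa [hh] at hmem

/-- **THE INDUCTIVE STEP OF T3b (i), PLACEMENT FORM.**  A junk placement `P` of the merger whose parts are canonically
admissibly placed, whose placed parts' `touch0` graph is connected from the host, and whose root read-outs are distinct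
within classes, has a top rearrangement `permTop σ P ∈ S zone ρ c₀ st (merge X Y e) (evalA c₀ P (rootAddr _))` with
`σ • cfg P` sorted. [folklore] -/
theorem exists_permTop_mem_S (hD : ∀ a ∈ baddr (Gen.merge X Y e), a.length ≤ D) {P : Addr D → γ}
    (hJ : Junk (Gen.merge X Y e) c₀ P) (hok : ∀ i, cfg c₀ st X Y e P i ∈ Sany zone ρ c₀ st (part st _ i).2)
    (hconn : ∀ i, (SimpleGraph.fromRel fun i j =>
      touch0 zone st X Y e i (cfg c₀ st X Y e P i) j (cfg c₀ st X Y e P j)).Reachable (hostIdx st X Y e) i)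
    (hρ : RootInj (key st X Y e) ρ (cfg c₀ st X Y e P)) :
    ∃ σ : keyPerms (key st X Y e), Sorted (key st X Y e) ρ (σ • cfg c₀ st X Y e P) ∧
      permTop c₀ st X Y e σ P ∈ S zone ρ c₀ st (Gen.merge X Y e) (evalA c₀ P (rootAddr (Gen.merge X Y e))) := by
  have _ := hJ
  obtain ⟨σ, -, hS, hmem⟩ := exists_glue_smul_mem_S hD hok hconn hρ
  refine ⟨σ, hS, ?_⟩
  rwa [evalA_cfg_host] at hmem

end Rearrange

/-! ## §3 Sanity -/

namespace Sanity

/-- gluing the constant configuration `fun _ _ => 7` of the top join of `merge (born 0 5) (born 0 5) 1` (two EQUAL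
births merged; addresses of length `≤ 1`) is junk off the two birth addresses -/
example : Junk (Gen.merge (Gen.born 0 5) (Gen.born 0 5) 1) (0 : ℕ)
    (glue (D := 1) 0 (fun n : ℕ => n) (Gen.born 0 5) (Gen.born 0 5) 1 fun _ _ => 7) :=
  junk_glue _

end Sanity

end

end Summit.QuantumFields.BalabanUV.T4Continuum.HistoryJoinsGlue
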